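import Mathlib.Algebra.Module.Torsion.Basic
import Mathlib.LinearAlgebra.FreeModule.Basic
import Literature.RingTheory.CompleteIntersection.CongruenceModule
import HarnessLib

/-!
# Congruence ideals and self-adjoint pairings on Hecke-type modules

Elementwise form of Darmon–Diamond–Taylor, *Fermat's Last Theorem*, Lemma 4.17 / Cor. 4.19
(pp. 126–127) and Wiles, *Modular elliptic curves and Fermat's Last Theorem*, Prop. 2.4 /
Lemma 2.5: for an augmented `O`-algebra `π : T →ₐ[O] O` acting on a module `L` with a
`T`-self-adjoint `O`-bilinear pairing `B`, the congruence ideal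
`η_π = π(Ann_T(ker π))` (`Literature.RingTheory.CompleteIntersection.congruenceIdeal`) is
pinned between values of the pairing on `L[℘]` (`℘ = ker π`):

* `pairing_mem_congruenceIdeal`       `B x y ∈ η_π` for `x ∈ Ann(℘)·L`, `y ∈ L[℘]`;
* `kerTorsion_le_annihilator_smul_top` `L[℘] ⊆ Ann(℘)·L` when `L` is free over `T`;
* `congruenceIdeal_le_span_pairing`   `η_π ⊆ (B x y)` when `L[℘] ⊆ ⟨x, y⟩_O` and `y` is
  `B`-unimodular;
* `map_kerTorsion_le`                 functoriality of `L[℘]` along an equivariant map;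
* `pairing_transport`                 `B' (ψ x) (ψ y) = π(c) · B x y` when `φ ∘ ψ = c`, `φ` adjoint
  to `ψ`.

These are the commutative-algebra bricks of the Ihara step `η_{Σ'} ⊆ π(c_q)·η_Σ`
(DDT Thm. 3.36) in the Taylor–Wiles–Diamond proof of `R_Σ = T_Σ`; no freeness over `O`,
perfectness or multiplicity-one hypothesis is used here.

References:
* H. Darmon, F. Diamond, R. Taylor, *Fermat's Last Theorem*, in: Current Developments in
  Mathematics 1995, International Press, 1–154: §3.3 (3.3.1), Thm. 3.36 p. 98, §4.4
  pp. 125–133, Lemma 4.17, Cor. 4.19. [DarmonDiamondTaylor1995]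
* A. Wiles, *Modular elliptic curves and Fermat's Last Theorem*, Ann. of Math. 141 (1995),
  443–551: Prop. 2.4, Lemma 2.5, pp. 494–496. [Wiles1995Annals]
-/

namespace Literature.RingTheory.CompleteIntersection

universe u v v' w w'

section SelfDual

variable {O : Type u} [CommRing O] {T : Type v} [CommRing T] [Algebra O T] (π : T →ₐ[O] O)
variable {L : Type w} [AddCommGroup L] [Module O L] [Module T L] [IsScalarTower O T L]

/-- `L[℘]`, `℘ = ker π`: the elements of the `T`-module `L` killed by the augmentation ideal, as an
`O`-submodule (DDT p. 126 "`L[℘]`").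
[cite: DarmonDiamondTaylor1995, §4.4 pp. 125–126] -/
abbrev kerTorsion : Submodule O L :=
  (Submodule.torsionBySet T L ((RingHom.ker π : Ideal T) : Set T)).restrictScalars O

/-- On `L[℘]` the algebra `T` acts through `π`: `t • y = π(t) • y` (DDT p. 133: "acts on
`L'_T[P]` by an element of `O = T_m/P`"). [cite: DarmonDiamondTaylor1995, §4.4 p. 133] -/
theorem smul_eq_of_mem_kerTorsion {y : L} (hy : y ∈ kerTorsion π (L := L)) (t : T) :
    t • y = π t • y := by
  have hmem : t - algebraMap O T (π t) ∈ RingHom.ker π := sub_algebraMap_mem_ker π t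
  have h0 : (t - algebraMap O T (π t)) • y = 0 := by
    rw [Submodule.restrictScalars_mem, Submodule.mem_torsionBySet_iff] at hy
    exact hy ⟨_, hmem⟩
  rw [sub_smul, sub_eq_zero, algebraMap_smul] at h0
  exact h0

/-- **A≥** (XS; PROVED; DDT Lemma 4.17, the inclusion `O·det ⊆ η^d` read elementwise; Wiles (2.4)):
for a `T`-self-adjoint pairing, `⟨x, y⟩ ∈ η_π` whenever `x ∈ Ann_T(℘)·L` and `y ∈ L[℘]`
(`⟨g u, y⟩ = ⟨u, g y⟩ = π(g)⟨u, y⟩`, `π(g) ∈ η`).  No freeness, no perfectness.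
[cite: DarmonDiamondTaylor1995, Lemma 4.17 p. 126] -/
theorem pairing_mem_congruenceIdeal (B : L →ₗ[O] L →ₗ[O] O)
    (hB : ∀ (t : T) (u v : L), B (t • u) v = B u (t • v)) {x y : L}
    (hx : x ∈ (RingHom.ker π).annihilator • (⊤ : Submodule T L))
    (hy : y ∈ kerTorsion π (L := L)) :
    B x y ∈ congruenceIdeal π := by
  refine Submodule.smul_induction_on (p := fun x => B x y ∈ congruenceIdeal π) hx ?_ ?_
  · intro g hg u _
    rw [hB, smul_eq_of_mem_kerTorsion π hy g, map_smul, smul_eq_mul]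
    exact Ideal.mul_mem_right _ _ (apply_mem_congruenceIdeal π hg)
  · intro u v hu hv
    rw [map_add, LinearMap.add_apply]
    exact Ideal.add_mem _ hu hv

omit [Module O L] [IsScalarTower O T L] in
/-- **A0** (S; PROVED): for `L` free over `T`, `L[℘] ⊆ Ann_T(℘)·L` (coordinates of a `℘`-torsion vector
in a `T`-basis are killed by `℘`).  This is where multiplicity one (`L_Σ` free of rank 2 over
`T_Σ`, DDT Thm. 4.18 / Wiles Thm. 2.1 Cor. 1) enters — at the LOWER level only (DDT Remark 4.25).
[cite: DarmonDiamondTaylor1995, Lemma 4.17 p. 126 ("equality holds if `L` is free")] -/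
theorem kerTorsion_le_annihilator_smul_top [Module.Free T L] :
    Submodule.torsionBySet T L ((RingHom.ker π : Ideal T) : Set T) ≤
      (RingHom.ker π).annihilator • (⊤ : Submodule T L) := by
  intro y hy
  rw [Submodule.mem_torsionBySet_iff] at hy
  let b := Module.Free.chooseBasis T L
  rw [← b.linearCombination_repr y, Finsupp.linearCombination_apply, Finsupp.sum]
  refine Submodule.sum_mem _ fun i _ => Submodule.smul_mem_smul ?_ Submodule.mem_top
  rw [mem_annihilator_ker_iff]
  intro s hs
  have h := congrArg (fun v => b.repr v i) (hy ⟨s, by simpa only [SetLike.mem_coe, RingHom.mem_ker] using hs⟩)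
  simp only [map_smul, map_zero, Finsupp.smul_apply, Finsupp.zero_apply, smul_eq_mul] at h
  rw [mul_comm]
  exact h

/-- **A≤** (S; PROVED; DDT Lemma 4.17 / Cor. 4.19, the inclusion `η ⊆ (⟨x, y⟩)` read elementwise): if
every `℘`-torsion vector is an `O`-combination of `x, y`, `⟨y, y⟩ = 0` and `y` is unimodular
(`⟨z, y⟩ = 1` for some `z`), then `η_π ⊆ (⟨x, y⟩)`: for `t ∈ Ann(℘)`, `t z ∈ L[℘]`, so
`t z = αx + βy` and `π(t) = π(t)⟨z, y⟩ = ⟨t z, y⟩ = α⟨x, y⟩`.  No freeness of `L` over `T`.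
[cite: DarmonDiamondTaylor1995, Cor. 4.19 p. 127] -/
theorem congruenceIdeal_le_span_pairing (B : L →ₗ[O] L →ₗ[O] O)
    (hB : ∀ (t : T) (u v : L), B (t • u) v = B u (t • v)) {x y : L}
    (hy : y ∈ kerTorsion π (L := L)) (hyy : B y y = 0) (hz : ∃ z, B z y = 1)
    (hspan : kerTorsion π (L := L) ≤ Submodule.span O {x, y}) :
    congruenceIdeal π ≤ Ideal.span {B x y} := by
  intro a ha
  obtain ⟨t, ht, rfl⟩ := (mem_congruenceIdeal_iff π).1 ha
  obtain ⟨z, hz⟩ := hz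
  have htz : t • z ∈ kerTorsion π (L := L) := by
    rw [Submodule.restrictScalars_mem, Submodule.mem_torsionBySet_iff]
    rintro ⟨s, hs⟩
    have h0 : t * s = 0 :=
      (mem_annihilator_ker_iff π).1 ht s (by simpa only [SetLike.mem_coe, RingHom.mem_ker] using hs)
    change s • t • z = 0
    rw [← mul_smul, mul_comm, h0, zero_smul]
  obtain ⟨α, β, hαβ⟩ := Submodule.mem_span_pair.1 (hspan htz)
  have h1 : B (t • z) y = π t := by
    rw [hB, smul_eq_of_mem_kerTorsion π hy t, map_smul, smul_eq_mul, hz, mul_one]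
  have key : π t = α * B x y := by
    rw [← h1, ← hαβ]
    simp only [map_add, map_smul, LinearMap.add_apply, LinearMap.smul_apply, hyy, smul_eq_mul,
      mul_zero, add_zero]
  rw [key]
  exact Ideal.mul_mem_left _ _ (Ideal.mem_span_singleton_self _)

end SelfDual

section Transport

variable {O : Type u} [CommRing O] {T : Type v} [CommRing T] [Algebra O T] (π : T →ₐ[O] O)
variable {T' : Type v'} [CommRing T'] [Algebra O T'] (f : T' →ₐ[O] T)
variable {L : Type w} [AddCommGroup L] [Module O L] [Module T L] [IsScalarTower O T L]
variable {L' : Type w'} [AddCommGroup L'] [Module O L'] [Module T' L'] [IsScalarTower O T' L']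

/-- **B1** (XS; PROVED): an `O`-linear `ψ : L → L'`, equivariant along `f : T' → T`
(`ψ(f(t') z) = t' ψ(z)`), maps `L[ker π]` into `L'[ker (π ∘ f)]` (DDT p. 132: `φ'_H` maps
`H¹(X, O')[P']` to `H¹(X', O')[P'']`). [cite: DarmonDiamondTaylor1995, §4.4 p. 132] -/
theorem map_kerTorsion_le (ψ : L →ₗ[O] L') (hψ : ∀ (t' : T') (z : L), ψ (f t' • z) = t' • ψ z) :
    (kerTorsion π (L := L)).map ψ ≤ kerTorsion (π.comp f) (L := L') := by
  rintro _ ⟨z, hz, rfl⟩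
  rw [SetLike.mem_coe, Submodule.restrictScalars_mem, Submodule.mem_torsionBySet_iff] at hz
  rw [Submodule.restrictScalars_mem, Submodule.mem_torsionBySet_iff]
  rintro ⟨s', hs'⟩
  have hs : f s' ∈ RingHom.ker π := by
    simpa only [SetLike.mem_coe, RingHom.mem_ker, AlgHom.coe_comp, Function.comp_apply] using hs'
  change s' • ψ z = 0
  rw [← hψ s' z, hz ⟨f s', hs⟩, map_zero]

/-- **C** (XS; PROVED; Wiles p. 496 "`u₁⁻¹ ∘ ξ̂ ∘ ξ ∘ u₂ = −q⁻¹(q−1)(T_q² − q(1+q)²)`", DDT p. 133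
"`φ_T φ'_T = −p⁻²(p−1)(T_p² − (p+1)²)`"): if the composite `φ ∘ ψ` is the action of `c ∈ T`,
then `⟨ψ x, ψ y⟩' = π(c)·⟨x, y⟩` for `y ∈ L[℘]`. [cite: DarmonDiamondTaylor1995, §4.4 p. 133] -/
theorem pairing_transport (B : L →ₗ[O] L →ₗ[O] O) (B' : L' →ₗ[O] L' →ₗ[O] O)
    (hB : ∀ (t : T) (u v : L), B (t • u) v = B u (t • v))
    (φ : L' →ₗ[O] L) (ψ : L →ₗ[O] L') (hadj : ∀ (w : L') (z : L), B (φ w) z = B' w (ψ z))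
    {c : T} (hc : ∀ z : L, φ (ψ z) = c • z) {x y : L} (hy : y ∈ kerTorsion π (L := L)) :
    B' (ψ x) (ψ y) = π c * B x y := by
  rw [← hadj (ψ x) y, hc x, hB, smul_eq_of_mem_kerTorsion π hy c, map_smul, smul_eq_mul]


end Transport

end Literature.RingTheory.CompleteIntersection
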